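/-
Copyright: lit-balaban Phase-2 proof seat p08 (gen 10).  Statement-level skeleton of a published paper; no proof claims beyond what
the kernel checks below.
-/
import Literature.MathematicalPhysics.QuantumFieldTheory.BalabanImbrieJaffe1984to88.BIJ88OpCloseDkLocGradTorus

/-!
# `BalabanImbrieJaffe1984to88.BIJ88W1PrimeCurlLeftFactorTorus` — T. Bałaban, J. Imbrie, A. Jaffe, *Effective action and cluster properties
of the abelian Higgs model*, Commun. Math. Phys. **114** (1988) 257–315 [BalabanImbrieJaffe1988], §5.4 p. 282 [PDF 26] with Sect. 2 (2.5),
(2.7) p. 260: **THE LEFT FACTOR OF `∂w′₁` / `∂*w′₁` — the output curl `(∂^ηH_j(·, b₁))(p)`, `(∂^ηH_{j,loc}(·, b₁))(p)`,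
`(∂^η(H_j − H_{j,loc})(·, b₁))(p)` and the output divergence of the same columns, bounded on the tori of record with the printed
`(L^jη)^{−1}` GAIN** — the factor that distinguishes the printed count for `∂w′₁`, «(L^jη)^{−1−(d−2)−1+(d−2)}», from the one for `w′₁`.

In the exact reduction of `(∂w′₁)(p, b′)` (this seat's `BIJ88W1Prime543CurlDivTorus`, on top of p02's `BIJ88W1Prime543Torus`) the output
derivative lands on the LEFT factor `H_j(·, b₁)` / `H_{j,loc}(·, b₁)` of every tail term only; this file bounds exactly those factors, from
this seat's `η`-shift-difference lemmas (`BIJ88OpCloseDkLocGradTorus.abs_hKer_shift_sub_le` = the gradient member of (I.7.2.2) for r18's `hKer`,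
`BIJ88CurlyDkLocGradTerm.abs_hlKer_shift_sub_le` = the product rule for `ζ_jH_j`, `abs_grad_hKer_sub_hlKer_le` = the (2.7) mechanism for
the derivative): `|(∂^ηH_j(·,b₁))(p)| ≤ 2L^k·L^{−j}Me^{−δ dist_j(p,b₁)}`, the `loc` column with `M(1 + C_σ/(R₀ − R₁))`, the difference column
with the extra smallness `e^{δ/2}e^{−(δ/2)R₁}` at rate `δ/2`; the divergence versions with `d` backward differences (anchor moved back by one
`η`-step: a factor `e^{δL^{−j}} ≤ e^{δ}`).  The generic step «shift-difference bound at the base point ⟹ curl / divergence bound» is §1.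
This is the p02/p08 split of r16's flip condition for row C2.Eq5.4.7 (HOME/STATUS 2026-08-22T02:38Z / 02:47Z / 03:04Z), ∂-side; it is
INDEPENDENT of p02's files (imports only this seat's `BIJ88OpCloseDkLocGradTorus`) and is consumed by the ∂-side estimate together with
p02's per-scale slab sums.

statement-level skeleton of published theorems with citation tags; proofs where landed; nothing here is a claim about the Yang–Mills mass gap

PDF held: `paper:balaban1988-cmp114-bij-abelian-higgs-effective-action` (journal page = PDF page + 256); p. 282 [PDF 26] tl.4–9 (text layer,
this session): «The kernel w′₁ = (𝒟_k − 𝒟_{k,loc})∂*Q^{e*}_k∂□ involves only the tails not included in the expansion (2.12). Using the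
regularity and exponential decay of H_j, H_{j,loc}, along with (2.7) and scaling properties of these kernels, we find that [display:
|(∂w′₁)(p,b′)| ≦ Σ_{j=1}^{k−1}(L^jη)^{−1−(d−2)−1+(d−2)}e^{−cr(e_j)}e^{−c dist(p,b′)} ≦ e^{−cr(e_k)}e^{−c dist(p,b′)}, per p02's/r16's image reading]
and similarly for w′₁, ∂*w′₁.»; p. 260 (2.5) `H_{k,loc}(b,b′) = ζ_k H_k(b,b′)`, (2.7) `|H_{k,loc}(b,b′) − H_k(b,b′)| ≦ e^{−cr(e_k)}e^{−c dist(b,b′)}`.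

CITATION HEADER (lean-in-tree rule).  Part of the lit-balaban TYPED SKELETON (HOME `run/shared/lean/pub/lit-balaban/`), Phase-2 proof seat
p08 (gen 10), unit `lit-balaban-p08`; free-target protocol G.5-34(d), TAKING line HOME/STATUS.md 2026-08-22T03:04:57Z (∂-side of the
C2.Eq5.4.7 flip programme).  WHAT IS REPRODUCED = SKELETON row **C2.Eq5.4.7** (owner r16, referee ref-5), the «regularity … of H_j, H_{j,loc},
along with (2.7) and scaling properties» ingredient of the printed `∂w′₁` bound, for the LEFT factor, kind «model instance for the kernels of
record».  Decls used BY NAME (nothing restated): r18's `BIJ88CurlyDkLocTorus.hKer` / `hlKer` ((2.4)/(2.5) on the torus), p09/p16's torus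
representation `torusRep … (deltaAData …)` of (I.7.2.2) (hypotheses `hH`, `hB` below, discharged per torus / over all tori from [6I] Prop. 1.2
in this seat's `BIJ88Decay223CkAllTori.exists_HB_allTori_of_prop12Printed` — the estimate file does that, not this one), p13's
`BIJ88Cutoffs21.cutoffProfile`, `LatticeFieldCalculus.curl` / `diverg` ((I.1.2)/(I.1.21)).

WHAT IS PROVED (0 `sorry`, standard axioms; theorems only):
* §1 GENERIC: `curl_eq_shift_sub` / `abs_curl_le_shift_sub` (the output curl at `p = ⟨x; μ < ν⟩` = two `η`-shift differences based at `x`),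
  `abs_diverg_le_sum` (`d` backward differences), **`abs_curl_le_of_shift_bound`** (`|(∂^cA)(p)| ≤ 2|c|β`), **`abs_diverg_le_of_shift_bound`**
  (`|(∂*^cA)(x)| ≤ |c|Σ_μβ_μ`), `abs_diverg_le_of_shift_bound'` (`≤ d|c|β`).
* §2 THE CURL OF THE COLUMNS (`∂^η = curl (L^k)`, any weights `w > 0`, `c ≠ 0`, `j ≤ m + K`, any `k`): **`abs_curl_hKer_le`**
  (`≤ 2L^kL^{−j}Me^{−δ dist_j(p,b₁)}`), **`abs_curl_hlKer_le`** (`M ↦ M(1 + C_σ/(R₀−R₁))`), **`abs_curl_hKer_sub_hlKer_le`**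
  (`≤ 2L^kL^{−j}M(1 + C_σ/(R₀−R₁))e^{δ/2}e^{−(δ/2)R₁}·e^{−(δ/2)dist_j(p,b₁)}` — the (2.7)-type smallness of the differenced left factor).
* §3 THE DIVERGENCE OF THE COLUMNS (`∂^{η*} = diverg (L^k)`): `exp_anchor_unshift_le` (moving the anchor back one `η`-step costs `≤ e^{δ}` for
  `δ ≥ 0`), **`abs_diverg_hKer_le`**, **`abs_diverg_hlKer_le`**, **`abs_diverg_hKer_sub_hlKer_le`** (`d·L^kL^{−j}·(…)·e^{δ′}·e^{−δ′dist_j(x,b₁)}`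
  with `δ′ = δ` resp. `δ/2`).
HONEST SCOPE.  (i) Left factor only; the right factor `G_j(b₂;p′) = (Q^e_k∂^ηH_j(·,b₂))(p′)`, the `C^{(j)}` factors, the `b₁,b₂`-sums, the slab
sums and the resummation over `j` are p02's `BIJ88W1Prime543Bound` and the ∂-side estimate file.  (ii) Hypotheses `hH`/`hB` = the sup and gradient
members of (I.7.2.2) in p09's torus representation, `hCζ` = a slope constant of the cutoff profile (this seat's `exists_cutoffProfile_lipschitz`
supplies one) — displayed, not discharged here.  (iii) `U = 1`, real abelian fields, torus, standing range.  (iv) No `def`, no new named fact;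
NOT summit progress.  Unit `lit-balaban-p08` (literature-prover-lit-balaban-p08-g10-0), 2026-08-22.
-/

open scoped BigOperators RealInnerProductSpace

namespace Literature.MathematicalPhysics.QuantumFieldTheory.BalabanImbrieJaffe1984to88.BIJ88W1PrimeCurlLeftFactorTorus

open Balaban1983to89 hiding Site Plaq
open Balaban1983to89.LatticeFieldCalculus
open BIJ85Prop521Torus BIJ85Prop522Torus BIJ85Sigma422Eta
open BIJ85Sect7Statements BIJ85Ineq722Torus
open BIJ85Ineq722DeltaA (deltaAData)
open BIJ88Cutoffs21 (cutoff cutoffProfile)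
open BIJ88CurlyDkLocTorus
open BIJ88CurlyDkLocGradTerm (abs_hlKer_shift_sub_le abs_distEU_shift_sub_le)
open BIJ88OpCloseDkLocGradTorus (abs_hKer_shift_sub_le abs_grad_hKer_sub_hlKer_le)
-- inside this namespace the bare `Site`/`Plaq` are the `ℤ^d` carriers of the QFT root; the torus ones are renamed:
open Balaban1983to89 renaming Site → TSite, Plaq → TPlaq

noncomputable section

variable {P : Params}

/-- `0 < L^n`. [folklore] -/
private theorem cast_pow_L_pos' (n : ℕ) : (0 : ℝ) < (P.L : ℝ) ^ n := pow_pos P.cast_L_pos n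

/-- `(x − e_μ) + e_μ = x` on the torus sites. [folklore] -/
private theorem shift_unshift' {i : ℕ} (x : TSite P i) (μ : Fin P.d) : (x.unshift μ).shift μ = x :=
  (shiftEquiv (P := P) (j := i) μ).right_inv x

/-! ## §1  Generic: the output curl / divergence from shift-difference bounds -/

/-- the output curl at `p = ⟨x; μ < ν⟩` is the difference of two `η`-shift differences based at `x`:
`(∂^cA)(p) = c[(A(⟨x+e_μ,ν⟩) − A(⟨x,ν⟩)) − (A(⟨x+e_ν,μ⟩) − A(⟨x,μ⟩))]`. [cite: Balaban1984PropagatorsI, (1.2) p.18] -/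
theorem curl_eq_shift_sub {n : ℕ} (c : ℝ) (A : PBond P n → ℝ) (p : TPlaq P n) :
    curl c A p = c * ((A ⟨p.src.shift p.μ, p.ν⟩ - A ⟨p.src, p.ν⟩) - (A ⟨p.src.shift p.ν, p.μ⟩ - A ⟨p.src, p.μ⟩)) := by
  simp only [curl, smul_eq_mul]
  ring

/-- `|(∂^cA)(p)| ≤ |c|·(|A(⟨x+e_μ,ν⟩) − A(⟨x,ν⟩)| + |A(⟨x+e_ν,μ⟩) − A(⟨x,μ⟩)|)`. [cite: Balaban1984PropagatorsI, (1.2) p.18] -/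
theorem abs_curl_le_shift_sub {n : ℕ} (c : ℝ) (A : PBond P n → ℝ) (p : TPlaq P n) :
    |curl c A p| ≤ |c| * (|A ⟨p.src.shift p.μ, p.ν⟩ - A ⟨p.src, p.ν⟩| + |A ⟨p.src.shift p.ν, p.μ⟩ - A ⟨p.src, p.μ⟩|) := by
  rw [curl_eq_shift_sub, abs_mul]
  exact mul_le_mul_of_nonneg_left (abs_sub _ _) (abs_nonneg c)

/-- `|(∂*^cA)(x)| ≤ |c|·Σ_μ |A(⟨x−e_μ,μ⟩) − A(⟨x,μ⟩)|`. [cite: Balaban1984PropagatorsI, (1.21) p.21] -/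
theorem abs_diverg_le_sum {n : ℕ} (c : ℝ) (A : PBond P n → ℝ) (x : TSite P n) :
    |diverg c A x| ≤ |c| * ∑ μ : Fin P.d, |A ⟨x.unshift μ, μ⟩ - A ⟨x, μ⟩| := by
  simp only [diverg, smul_eq_mul]
  rw [Finset.mul_sum]
  refine (Finset.abs_sum_le_sum_abs _ _).trans (Finset.sum_le_sum fun μ _ => ?_)
  rw [abs_mul]

/-- **OUTPUT CURL FROM A SHIFT-DIFFERENCE BOUND**: if every `η`-shift difference of `A` based at the base point `x` of `p` is `≤ β`, then
`|(∂^cA)(p)| ≤ 2|c|β`. [cite: Balaban1984PropagatorsI, (1.2) p.18] -/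
theorem abs_curl_le_of_shift_bound {n : ℕ} (c : ℝ) (A : PBond P n → ℝ) (p : TPlaq P n) {β : ℝ}
    (h : ∀ (lam κ : Fin P.d), |A ⟨p.src.shift lam, κ⟩ - A ⟨p.src, κ⟩| ≤ β) :
    |curl c A p| ≤ 2 * |c| * β := by
  have h1 := h p.μ p.ν
  have h2 := h p.ν p.μ
  calc |curl c A p| ≤ |c| * (|A ⟨p.src.shift p.μ, p.ν⟩ - A ⟨p.src, p.ν⟩| + |A ⟨p.src.shift p.ν, p.μ⟩ - A ⟨p.src, p.μ⟩|) :=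
        abs_curl_le_shift_sub c A p
    _ ≤ |c| * (β + β) := mul_le_mul_of_nonneg_left (add_le_add h1 h2) (abs_nonneg c)
    _ = 2 * |c| * β := by ring

/-- **OUTPUT DIVERGENCE FROM SHIFT-DIFFERENCE BOUNDS**: if for each `μ` the `η`-shift difference of `A` based at `x − e_μ` is `≤ β μ`, then
`|(∂*^cA)(x)| ≤ |c|·Σ_μ β μ`. [cite: Balaban1984PropagatorsI, (1.21) p.21] -/
theorem abs_diverg_le_of_shift_bound {n : ℕ} (c : ℝ) (A : PBond P n → ℝ) (x : TSite P n) {β : Fin P.d → ℝ}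
    (h : ∀ μ : Fin P.d, |A ⟨(x.unshift μ).shift μ, μ⟩ - A ⟨x.unshift μ, μ⟩| ≤ β μ) :
    |diverg c A x| ≤ |c| * ∑ μ : Fin P.d, β μ := by
  refine (abs_diverg_le_sum c A x).trans (mul_le_mul_of_nonneg_left (Finset.sum_le_sum fun μ _ => ?_) (abs_nonneg c))
  have hμ := h μ
  rw [shift_unshift'] at hμ
  rwa [abs_sub_comm]

/-- the same with a uniform bound: `|(∂*^cA)(x)| ≤ d·|c|·β`. [cite: Balaban1984PropagatorsI, (1.21) p.21] -/
theorem abs_diverg_le_of_shift_bound' {n : ℕ} (c : ℝ) (A : PBond P n → ℝ) (x : TSite P n) {β : ℝ}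
    (h : ∀ μ : Fin P.d, |A ⟨(x.unshift μ).shift μ, μ⟩ - A ⟨x.unshift μ, μ⟩| ≤ β) :
    |diverg c A x| ≤ P.d * |c| * β := by
  calc |diverg c A x| ≤ |c| * ∑ _μ : Fin P.d, β := abs_diverg_le_of_shift_bound c A x h
    _ = P.d * |c| * β := by rw [Finset.sum_const, Finset.card_univ, Fintype.card_fin, nsmul_eq_mul]; ring

/-- **moving the anchor back one `η`-step**: `e^{−δ′dist_j(x − e_μ, y)} ≤ e^{δ′}·e^{−δ′dist_j(x, y)}` for `δ′ ≥ 0` (one `η`-step moves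
`dist_j` by at most `L^{−j} ≤ 1`, this seat's `abs_distEU_shift_sub_le`). [cite: BalabanImbrieJaffe1985, (7.2.2) p.325] -/
theorem exp_anchor_unshift_le {δ' : ℝ} (hδ' : 0 ≤ δ') (j : ℕ) (x : TSite P 0) (μ : Fin P.d) (y : TSite P j) :
    Real.exp (-(δ' * distEU P j (x.unshift μ) y)) ≤ Real.exp δ' * Real.exp (-(δ' * distEU P j x y)) := by
  have hstep := abs_distEU_shift_sub_le (P := P) j (x.unshift μ) μ y
  rw [shift_unshift', abs_le] at hstep
  have hLinv : ((P.L : ℝ) ^ j)⁻¹ ≤ 1 := inv_le_one_of_one_le₀ (one_le_pow₀ (by exact_mod_cast P.L_pos))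
  rw [← Real.exp_add]
  refine Real.exp_le_exp.2 ?_
  have h1 : distEU P j x y - 1 ≤ distEU P j (x.unshift μ) y := by linarith [hstep.2]
  nlinarith [mul_le_mul_of_nonneg_left h1 hδ']

/-! ## §2  The output curl of the columns `H_j(·, b₁)`, `H_{j,loc}(·, b₁)`, `(H_j − H_{j,loc})(·, b₁)` -/

section Columns

variable {j : ℕ} (hj : j ≤ P.m + P.K) {w c : ℝ} (hw : 0 < w) (hc : c ≠ 0) {a : ℝ} (ha : 0 < a) {δ M : ℝ}

include hw hc ha

/-- **`|(∂^ηH_j(·, b₁))(p)| ≤ 2L^k·L^{−j}Me^{−δ dist_j(p, b₁)}`** (`∂^η = curl (L^k)`; `dist_j(p,b₁) = |p₋ − y_{b₁}|_∞/L^j`, p09's `distEU`): the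
printed «regularity and … scaling properties» of `H_j` — the gradient member of (I.7.2.2) — read through the output curl; the factor
`L^k·L^{−j} = (L^jη)^{−1}` is the printed gain. [cite: BalabanImbrieJaffe1988, (5.4.3) p.282] -/
theorem abs_curl_hKer_le
    (hB : ∀ (μ ν : Fin P.d) (x : TSite P 0) (y : TSite P j),
      ‖fun lam : Fin P.d => (P.L : ℝ) ^ j *
          ((torusRep P j (deltaAData hj a)).H (x.shift lam, μ) (y, ν) - (torusRep P j (deltaAData hj a)).H (x, μ) (y, ν))‖ ≤
        M * Real.exp (-(δ * distEU P j x y)))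
    (k : ℕ) (p : TPlaq P 0) (b₁ : PBond P j) :
    |curl ((P.L : ℝ) ^ k) (fun b : PBond P 0 => hKer (P := P) w c j b b₁) p| ≤
      2 * (P.L : ℝ) ^ k * (((P.L : ℝ) ^ j)⁻¹ * M * Real.exp (-(δ * distEU P j p.src b₁.src))) := by
  have h := abs_curl_le_of_shift_bound ((P.L : ℝ) ^ k) (fun b : PBond P 0 => hKer (P := P) w c j b b₁) p
    (β := ((P.L : ℝ) ^ j)⁻¹ * M * Real.exp (-(δ * distEU P j p.src b₁.src)))
    (fun lam κ => abs_hKer_shift_sub_le hj hw hc ha hB p.src κ lam b₁)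
  rwa [abs_of_pos (cast_pow_L_pos' k)] at h

/-- **`|(∂^ηH_{j,loc}(·, b₁))(p)| ≤ 2L^k·L^{−j}M(1 + C_σ/(R₀ − R₁))e^{−δ dist_j(p, b₁)}`** (`H_{j,loc} = ζ_jH_j`, radii `R₁ < R₀`, slope constant
`C_σ` of the profile: this seat's product rule `abs_hlKer_shift_sub_le`). [cite: BalabanImbrieJaffe1988, (2.5) p.260] -/
theorem abs_curl_hlKer_le
    (hH : ∀ (μ ν : Fin P.d) (x : TSite P 0) (y : TSite P j),
      |(torusRep P j (deltaAData hj a)).H (x, μ) (y, ν)| ≤ M * Real.exp (-(δ * distEU P j x y)))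
    (hB : ∀ (μ ν : Fin P.d) (x : TSite P 0) (y : TSite P j),
      ‖fun lam : Fin P.d => (P.L : ℝ) ^ j *
          ((torusRep P j (deltaAData hj a)).H (x.shift lam, μ) (y, ν) - (torusRep P j (deltaAData hj a)).H (x, μ) (y, ν))‖ ≤
        M * Real.exp (-(δ * distEU P j x y)))
    {C R₁ R₀ : ℝ} (hC0 : 0 ≤ C) (hR : R₁ < R₀)
    (hCζ : ∀ t s : ℝ, |cutoffProfile R₁ R₀ t - cutoffProfile R₁ R₀ s| ≤ C / (R₀ - R₁) * |t - s|)
    (k : ℕ) (p : TPlaq P 0) (b₁ : PBond P j) :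
    |curl ((P.L : ℝ) ^ k) (fun b : PBond P 0 => hlKer (P := P) w c R₁ R₀ j b b₁) p| ≤
      2 * (P.L : ℝ) ^ k * (((P.L : ℝ) ^ j)⁻¹ * (M * (1 + C / (R₀ - R₁))) * Real.exp (-(δ * distEU P j p.src b₁.src))) := by
  have h := abs_curl_le_of_shift_bound ((P.L : ℝ) ^ k) (fun b : PBond P 0 => hlKer (P := P) w c R₁ R₀ j b b₁) p
    (β := ((P.L : ℝ) ^ j)⁻¹ * (M * (1 + C / (R₀ - R₁))) * Real.exp (-(δ * distEU P j p.src b₁.src)))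
    (fun lam κ => abs_hlKer_shift_sub_le hj hw hc ha hH hB hC0 hR hCζ p.src κ lam b₁)
  rwa [abs_of_pos (cast_pow_L_pos' k)] at h

/-- **`|(∂^η(H_j − H_{j,loc})(·, b₁))(p)| ≤ 2L^k·L^{−j}M(1 + C_σ/(R₀ − R₁))e^{δ/2}e^{−(δ/2)R₁}·e^{−(δ/2)dist_j(p, b₁)}`** (`δ ≥ 0`): the
differenced left factor carries BOTH the `(L^jη)^{−1}` gain AND the (2.7)-type smallness `e^{−(δ/2)R₁}` in the inner radius (this seat's
`abs_grad_hKer_sub_hlKer_le`: `(1 − ζ_j)H_j` and its `η`-difference vanish within `R₁` of `b₁`). [cite: BalabanImbrieJaffe1988, (2.7) p.260] -/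
theorem abs_curl_hKer_sub_hlKer_le (hδ : 0 ≤ δ)
    (hH : ∀ (μ ν : Fin P.d) (x : TSite P 0) (y : TSite P j),
      |(torusRep P j (deltaAData hj a)).H (x, μ) (y, ν)| ≤ M * Real.exp (-(δ * distEU P j x y)))
    (hB : ∀ (μ ν : Fin P.d) (x : TSite P 0) (y : TSite P j),
      ‖fun lam : Fin P.d => (P.L : ℝ) ^ j *
          ((torusRep P j (deltaAData hj a)).H (x.shift lam, μ) (y, ν) - (torusRep P j (deltaAData hj a)).H (x, μ) (y, ν))‖ ≤
        M * Real.exp (-(δ * distEU P j x y)))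
    {C R₁ R₀ : ℝ} (hC0 : 0 ≤ C) (hR : R₁ < R₀)
    (hCζ : ∀ t s : ℝ, |cutoffProfile R₁ R₀ t - cutoffProfile R₁ R₀ s| ≤ C / (R₀ - R₁) * |t - s|)
    (k : ℕ) (p : TPlaq P 0) (b₁ : PBond P j) :
    |curl ((P.L : ℝ) ^ k) (fun b : PBond P 0 => hKer (P := P) w c j b b₁ - hlKer (P := P) w c R₁ R₀ j b b₁) p| ≤
      2 * (P.L : ℝ) ^ k * ((((P.L : ℝ) ^ j)⁻¹ * (M * (1 + C / (R₀ - R₁)) * Real.exp (δ / 2) * Real.exp (-(δ / 2 * R₁)))) *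
        Real.exp (-(δ / 2 * distEU P j p.src b₁.src))) := by
  have h := abs_curl_le_of_shift_bound ((P.L : ℝ) ^ k)
    (fun b : PBond P 0 => hKer (P := P) w c j b b₁ - hlKer (P := P) w c R₁ R₀ j b b₁) p
    (β := (((P.L : ℝ) ^ j)⁻¹ * (M * (1 + C / (R₀ - R₁)) * Real.exp (δ / 2) * Real.exp (-(δ / 2 * R₁)))) *
        Real.exp (-(δ / 2 * distEU P j p.src b₁.src)))
    (fun lam κ => abs_grad_hKer_sub_hlKer_le hj hw hc ha hδ hH hB hC0 hR hCζ p.src κ lam b₁)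
  rwa [abs_of_pos (cast_pow_L_pos' k)] at h

/-! ## §3  The output divergence of the same columns -/

/-- **`|(∂^{η*}H_j(·, b₁))(x)| ≤ d·L^k·(L^{−j}M)·e^{δ}e^{−δ dist_j(x, b₁)}`** (`δ ≥ 0`; `d` backward differences, each a forward difference based at
`x − e_μ`). [cite: BalabanImbrieJaffe1988, (5.4.3) p.282] -/
theorem abs_diverg_hKer_le (hδ : 0 ≤ δ)
    (hB : ∀ (μ ν : Fin P.d) (x : TSite P 0) (y : TSite P j),
      ‖fun lam : Fin P.d => (P.L : ℝ) ^ j *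
          ((torusRep P j (deltaAData hj a)).H (x.shift lam, μ) (y, ν) - (torusRep P j (deltaAData hj a)).H (x, μ) (y, ν))‖ ≤
        M * Real.exp (-(δ * distEU P j x y)))
    (k : ℕ) (x : TSite P 0) (b₁ : PBond P j) :
    |diverg ((P.L : ℝ) ^ k) (fun b : PBond P 0 => hKer (P := P) w c j b b₁) x| ≤
      P.d * (P.L : ℝ) ^ k * (((P.L : ℝ) ^ j)⁻¹ * M * (Real.exp δ * Real.exp (-(δ * distEU P j x b₁.src)))) := by
  have hLj : 0 < (P.L : ℝ) ^ j := cast_pow_L_pos' j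
  have hM : 0 ≤ M := by
    have h := hB ⟨0, P.hd⟩ ⟨0, P.hd⟩ default default
    exact (mul_nonneg_iff_of_pos_right (Real.exp_pos _)).1 ((norm_nonneg _).trans h)
  have h := abs_diverg_le_of_shift_bound' ((P.L : ℝ) ^ k) (fun b : PBond P 0 => hKer (P := P) w c j b b₁) x
    (β := ((P.L : ℝ) ^ j)⁻¹ * M * (Real.exp δ * Real.exp (-(δ * distEU P j x b₁.src))))
    (fun μ => (abs_hKer_shift_sub_le hj hw hc ha hB (x.unshift μ) μ μ b₁).trans
      (mul_le_mul_of_nonneg_left (exp_anchor_unshift_le hδ j x μ b₁.src)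
        (mul_nonneg (inv_nonneg.2 hLj.le) hM)))
  rwa [abs_of_pos (cast_pow_L_pos' k)] at h

/-- **`|(∂^{η*}H_{j,loc}(·, b₁))(x)| ≤ d·L^k·(L^{−j}M(1 + C_σ/(R₀ − R₁)))·e^{δ}e^{−δ dist_j(x, b₁)}`** (`δ ≥ 0`).
[cite: BalabanImbrieJaffe1988, (2.5) p.260] -/
theorem abs_diverg_hlKer_le (hδ : 0 ≤ δ)
    (hH : ∀ (μ ν : Fin P.d) (x : TSite P 0) (y : TSite P j),
      |(torusRep P j (deltaAData hj a)).H (x, μ) (y, ν)| ≤ M * Real.exp (-(δ * distEU P j x y)))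
    (hB : ∀ (μ ν : Fin P.d) (x : TSite P 0) (y : TSite P j),
      ‖fun lam : Fin P.d => (P.L : ℝ) ^ j *
          ((torusRep P j (deltaAData hj a)).H (x.shift lam, μ) (y, ν) - (torusRep P j (deltaAData hj a)).H (x, μ) (y, ν))‖ ≤
        M * Real.exp (-(δ * distEU P j x y)))
    {C R₁ R₀ : ℝ} (hC0 : 0 ≤ C) (hR : R₁ < R₀)
    (hCζ : ∀ t s : ℝ, |cutoffProfile R₁ R₀ t - cutoffProfile R₁ R₀ s| ≤ C / (R₀ - R₁) * |t - s|)
    (k : ℕ) (x : TSite P 0) (b₁ : PBond P j) :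
    |diverg ((P.L : ℝ) ^ k) (fun b : PBond P 0 => hlKer (P := P) w c R₁ R₀ j b b₁) x| ≤
      P.d * (P.L : ℝ) ^ k * (((P.L : ℝ) ^ j)⁻¹ * (M * (1 + C / (R₀ - R₁))) *
        (Real.exp δ * Real.exp (-(δ * distEU P j x b₁.src)))) := by
  have hLj : 0 < (P.L : ℝ) ^ j := cast_pow_L_pos' j
  have hM : 0 ≤ M := by
    have h := hH ⟨0, P.hd⟩ ⟨0, P.hd⟩ default default
    exact (mul_nonneg_iff_of_pos_right (Real.exp_pos _)).1 ((abs_nonneg _).trans h)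
  have hM' : 0 ≤ M * (1 + C / (R₀ - R₁)) := mul_nonneg hM (by positivity [sub_pos.2 hR])
  have h := abs_diverg_le_of_shift_bound' ((P.L : ℝ) ^ k) (fun b : PBond P 0 => hlKer (P := P) w c R₁ R₀ j b b₁) x
    (β := ((P.L : ℝ) ^ j)⁻¹ * (M * (1 + C / (R₀ - R₁))) * (Real.exp δ * Real.exp (-(δ * distEU P j x b₁.src))))
    (fun μ => (abs_hlKer_shift_sub_le hj hw hc ha hH hB hC0 hR hCζ (x.unshift μ) μ μ b₁).trans
      (mul_le_mul_of_nonneg_left (exp_anchor_unshift_le hδ j x μ b₁.src)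
        (mul_nonneg (inv_nonneg.2 hLj.le) hM')))
  rwa [abs_of_pos (cast_pow_L_pos' k)] at h

/-- **`|(∂^{η*}(H_j − H_{j,loc})(·, b₁))(x)| ≤ d·L^k·(L^{−j}M(1 + C_σ/(R₀ − R₁))e^{δ/2}e^{−(δ/2)R₁})·e^{δ/2}e^{−(δ/2)dist_j(x, b₁)}`** (`δ ≥ 0`) —
gain and (2.7)-type smallness together, divergence form. [cite: BalabanImbrieJaffe1988, (2.7) p.260] -/
theorem abs_diverg_hKer_sub_hlKer_le (hδ : 0 ≤ δ)
    (hH : ∀ (μ ν : Fin P.d) (x : TSite P 0) (y : TSite P j),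
      |(torusRep P j (deltaAData hj a)).H (x, μ) (y, ν)| ≤ M * Real.exp (-(δ * distEU P j x y)))
    (hB : ∀ (μ ν : Fin P.d) (x : TSite P 0) (y : TSite P j),
      ‖fun lam : Fin P.d => (P.L : ℝ) ^ j *
          ((torusRep P j (deltaAData hj a)).H (x.shift lam, μ) (y, ν) - (torusRep P j (deltaAData hj a)).H (x, μ) (y, ν))‖ ≤
        M * Real.exp (-(δ * distEU P j x y)))
    {C R₁ R₀ : ℝ} (hC0 : 0 ≤ C) (hR : R₁ < R₀)
    (hCζ : ∀ t s : ℝ, |cutoffProfile R₁ R₀ t - cutoffProfile R₁ R₀ s| ≤ C / (R₀ - R₁) * |t - s|)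
    (k : ℕ) (x : TSite P 0) (b₁ : PBond P j) :
    |diverg ((P.L : ℝ) ^ k) (fun b : PBond P 0 => hKer (P := P) w c j b b₁ - hlKer (P := P) w c R₁ R₀ j b b₁) x| ≤
      P.d * (P.L : ℝ) ^ k * ((((P.L : ℝ) ^ j)⁻¹ * (M * (1 + C / (R₀ - R₁)) * Real.exp (δ / 2) * Real.exp (-(δ / 2 * R₁)))) *
        (Real.exp (δ / 2) * Real.exp (-(δ / 2 * distEU P j x b₁.src)))) := by
  have hLj : 0 < (P.L : ℝ) ^ j := cast_pow_L_pos' j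
  have hM : 0 ≤ M := by
    have h := hH ⟨0, P.hd⟩ ⟨0, P.hd⟩ default default
    exact (mul_nonneg_iff_of_pos_right (Real.exp_pos _)).1 ((abs_nonneg _).trans h)
  have hK : 0 ≤ ((P.L : ℝ) ^ j)⁻¹ * (M * (1 + C / (R₀ - R₁)) * Real.exp (δ / 2) * Real.exp (-(δ / 2 * R₁))) := by
    have : 0 < R₀ - R₁ := sub_pos.2 hR
    positivity
  have hδ2 : 0 ≤ δ / 2 := by linarith
  have h := abs_diverg_le_of_shift_bound' ((P.L : ℝ) ^ k)
    (fun b : PBond P 0 => hKer (P := P) w c j b b₁ - hlKer (P := P) w c R₁ R₀ j b b₁) x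
    (β := (((P.L : ℝ) ^ j)⁻¹ * (M * (1 + C / (R₀ - R₁)) * Real.exp (δ / 2) * Real.exp (-(δ / 2 * R₁)))) *
        (Real.exp (δ / 2) * Real.exp (-(δ / 2 * distEU P j x b₁.src))))
    (fun μ => (abs_grad_hKer_sub_hlKer_le hj hw hc ha hδ hH hB hC0 hR hCζ (x.unshift μ) μ μ b₁).trans
      (mul_le_mul_of_nonneg_left (exp_anchor_unshift_le hδ2 j x μ b₁.src) hK))
  rwa [abs_of_pos (cast_pow_L_pos' k)] at h

end Columns

end

end Literature.MathematicalPhysics.QuantumFieldTheory.BalabanImbrieJaffe1984to88.BIJ88W1PrimeCurlLeftFactorTorus
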